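import Summits.Ventures.HodgeRepro2.T5GaloisTransport
import Summits.Ventures.HodgeRepro2.T5CoprimeCompositum

/-!
# T5SplittingOrbitNumberField — «D = ∅ or D = all» for a tower of Galois number fields
`ℚ ⊆ K ⊆ L`: the number of primes of `L` above a prime `𝔭` of `K` is constant on the
`Gal(K/ℚ)`-orbit of `𝔭`

Kernel witness (cell pub-hodge-repro2, seat p3, Tier-5 support for sub-step N2) for the clause of
route/T5-N2-route-3.md §N2.8.2(c): «“w non-split in E” is constant on the Gal(F⁺/ℚ)-orbit of
dyadic places since every σ ∈ Gal(F⁺/ℚ) extends to E (E/ℚ Galois) ✓ — so D = ∅ or D = all»,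
with `K = F⁺`, `L = E`, `p = (2)` and «non-split» = «exactly one prime of `L` above».

What is kernel-checked here (Mathlib's `galRestrict` / `IsIntegralClosure.MulSemiringAction` /
`IsGaloisGroup.of_isFractionRing` and the cell's own T5GaloisTransport (p393971) and
T5CoprimeCompositum (p393430)):

* `algebraMap_galRestrict_restrictNormal`: the inclusion `𝓞_K → 𝓞_L` intertwines the action of
  `g ∈ Gal(L/ℚ)` on `𝓞_L` with the action of its restriction `g|_K` on `𝓞_K` — «every
  σ ∈ Gal(F⁺/ℚ) extends to E» in action form;
* `ncard_primesOver_smul`: for `m ∈ Gal(K/ℚ)` (lifted to `Gal(L/ℚ)` by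
  `AlgEquiv.restrictNormalHom_surjective`), the number of primes of `𝓞_L` over `m • 𝔭` equals
  the number over `𝔭`;
* `countSet_eq_empty_or_univ`: for every rational prime `p` and every `n`, the set of primes of
  `K` over `p` with exactly `n` primes of `L` above them is empty or everything (Mathlib:
  `Gal(K/ℚ)` acts transitively on the primes over `p`) — with `n = 1`, `p = (2)`:
  «D = ∅ or D = all».

What stays prose (labels unchanged): that `2` is unramified in `F⁺` (N2.8.2(b)) and that
«non-split in E» means `n = 1`.

README §8(d): this file uses an L-value-free non-vanishing device: NO.
-/

namespace Summit.Ventures.HodgeRepro2.T5SplittingOrbitNumberField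

open NumberField Ideal
open scoped Pointwise

variable (K L : Type*) [Field K] [NumberField K] [Field L] [NumberField L] [Algebra K L]
  [IsGalois ℚ K] [IsGalois ℚ L]

/-- The inclusion `𝓞_K → 𝓞_L` intertwines `g|_K` on `𝓞_K` with `g` on `𝓞_L`. -/
theorem algebraMap_galRestrict_restrictNormal (g : Gal(L/ℚ)) (a : 𝓞 K) :
    algebraMap (𝓞 K) (𝓞 L) (galRestrict ℤ ℚ K (𝓞 K) (AlgEquiv.restrictNormalHom K g) a) =
      galRestrict ℤ ℚ L (𝓞 L) g (algebraMap (𝓞 K) (𝓞 L) a) := by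
  apply IsFractionRing.injective (𝓞 L) L
  rw [algebraMap_galRestrict_apply, ← IsScalarTower.algebraMap_apply (𝓞 K) (𝓞 L) L,
    ← IsScalarTower.algebraMap_apply (𝓞 K) (𝓞 L) L, IsScalarTower.algebraMap_apply (𝓞 K) K L,
    IsScalarTower.algebraMap_apply (𝓞 K) K L, algebraMap_galRestrict_apply]
  exact AlgEquiv.restrictNormal_commutes g K _

/-- The number of primes of `𝓞_L` over `m • 𝔭` equals the number over `𝔭`, for
`m ∈ Gal(K/ℚ)` acting on `𝓞_K` (Mathlib's `IsIntegralClosure.MulSemiringAction`). -/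
theorem ncard_primesOver_smul (m : Gal(K/ℚ)) (𝔭 : Ideal (𝓞 K)) :
    letI := IsIntegralClosure.MulSemiringAction ℤ ℚ K (𝓞 K)
    (primesOver (m • 𝔭) (𝓞 L)).ncard = (primesOver 𝔭 (𝓞 L)).ncard := by
  letI := IsIntegralClosure.MulSemiringAction ℤ ℚ K (𝓞 K)
  obtain ⟨g, rfl⟩ := AlgEquiv.restrictNormalHom_surjective L m
  rw [Ideal.pointwise_smul_eq_comap]
  refine (T5GaloisTransport.ncard_primesOver_comap
    (MulSemiringAction.toRingAut Gal(K/ℚ) (𝓞 K) (AlgEquiv.restrictNormalHom K g)).symm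
    (galRestrict ℤ ℚ L (𝓞 L) g⁻¹).toRingEquiv ?_ 𝔭).symm
  intro a
  simp only [MulSemiringAction.toRingAut_apply, MulSemiringAction.toRingEquiv_apply_symm_apply,
    ← map_inv]
  exact (algebraMap_galRestrict_restrictNormal K L g⁻¹ a).symm

/-- «D = ∅ or D = all»: for every prime `p` of `ℤ` and every `n`, the set of primes of `K` over
`p` with exactly `n` primes of `L` above them is empty or everything. -/
theorem countSet_eq_empty_or_univ (p : Ideal ℤ) (n : ℕ) :
    {Q : primesOver p (𝓞 K) | (primesOver Q.1 (𝓞 L)).ncard = n} = ∅ ∨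
      {Q : primesOver p (𝓞 K) | (primesOver Q.1 (𝓞 L)).ncard = n} = Set.univ := by
  classical
  letI := IsIntegralClosure.MulSemiringAction ℤ ℚ K (𝓞 K)
  haveI := IsGaloisGroup.of_isFractionRing Gal(K/ℚ) ℤ (𝓞 K) ℚ K
  haveI : Finite Gal(K/ℚ) := Finite.of_fintype _
  have hT := Ideal.isPretransitive_of_isGaloisGroup (B := 𝓞 K) p Gal(K/ℚ)
  refine @T5CoprimeCompositum.eq_empty_or_univ_of_smul_stable Gal(K/ℚ) (primesOver p (𝓞 K)) _ _ hT
    _ ?_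
  intro m Q hQ
  change (primesOver (m • Q.1) (𝓞 L)).ncard = n
  rw [ncard_primesOver_smul K L m Q.1]
  exact hQ

end Summit.Ventures.HodgeRepro2.T5SplittingOrbitNumberField
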